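import Summits.AtomisticToContinuum.Crystallization.Theorems.FrustratedLawDichotomyStrainedPatchHomLatticeBox

/-!
# The INDEX-BOX ENUMERATION lemma for the lattice sums of `(H)` under `‖G − 1‖ ≤ 1/4` — hcp family, record literals
# (27623 strained-patch piece; decomp-a2c, prover hand 2, generation 20; critic row 758 instruction, hcp twin of `…HomLatticeBox`)

For the hcp family the displacement set of record is `T_A = G·L_hex ∪ (G·L_hex + G(hcpShift + ξ))` (`…HomLattice.locHom_hcpA`), with the tree's
`hexFrame = ((1,0,0), (1/2,√3/2,0), (0,0,√(8/3)))` and `hcpShift = (1/2, √3/6, √(2/3))`.  This DEF-FREE module proves, at the record literals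
`‖G − 1‖ ≤ 1/4`, `‖ξ‖ ≤ 1/4`, range `9/2` (`W₄₅ = effPot w₄₅ ω₄ (3/400)`), box `[−7, 7]³`:

* §1 coordinates and norms of the undeformed points `latPt 1 hexFrame b` and `latPt 1 hexFrame b + hcpShift`:
  `‖P b‖² = b₁² + b₁b₂ + b₂² + (8/3)b₃²`, `‖P b + s‖² = (b₁ + b₂/2 + 1/2)² + ¾(b₂ + 1/3)² + (8/3)(b₃ + 1/2)²`;
* §2 `P` is injective (`‖P b‖ ≥ 1` off `0`), the shifted family never meets the unshifted one and never vanishes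
  (`‖P b + s + ξ‖ > 1/2`, hence `‖G(P b + s + ξ)‖ > 3/8`);
* §3 COORDINATE BOXES: `‖P b‖ < 6 ⟹ b ∈ [−7,7]³`, `‖P b + s‖ < 25/4 ⟹ b ∈ [−7,7]³`;
* §4 ★★ ENUMERATION `latticeSum_hcp_eq_boxSum_record`:
  `∑ᶠ v ∈ T_A ∖ 0, W₄₅ ‖v‖ = Σ_{b ∈ [−7,7]³ ∖ 0} W₄₅ ‖latPt G hexFrame b‖ + Σ_{b ∈ [−7,7]³} W₄₅ ‖latPt G hexFrame b + G (hcpShift + ξ)‖`;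
* §5 ★★ `homFloor_of_boxSums`: `HomFloor m` from the two BOX-SUM inequalities (fcc box from `…HomLatticeBox`, hcp box from §4) — the literal
  top-level statement a certificate over `(G, ξ)` has to establish (critic row 758).

0 sorry; no definitions; axioms ⊆ {propext, Classical.choice, Quot.sound}.  `--supports stmt-AtomisticToContinuum-27623`.
-/

noncomputable section

namespace Summit.AtomisticToContinuum.Crystallization.Theorems.FrustratedLawDichotomyStrainedPatchHomLatticeBoxHcp

open scoped BigOperators Classical
open Summit.AtomisticToContinuum.Crystallization.Theorems.ChargedEnergyGapNegative (E3)
open Summit.AtomisticToContinuum.Crystallization.Theorems.FrustratedLawDichotomySchurCut (effPot w₄₅ ω₄ effPot_fourHalf_eq_zero)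
open Summit.AtomisticToContinuum.Crystallization.Theorems.FrustratedLawDichotomyStrainedPatchHomSplit
open Summit.AtomisticToContinuum.Crystallization.Theorems.FrustratedLawDichotomyStrainedPatchHomLattice
open Summit.AtomisticToContinuum.Crystallization.Theorems.FrustratedLawDichotomyStrainedPatchHomRelief
open Summit.AtomisticToContinuum.Crystallization.Theorems.FrustratedLawDichotomyStrainedPatchHomLatticeBox
open Literature.Barriers.AtomisticToContinuum.FlatleyTheil2015 (fccVec)

/-! ## §1. Coordinates and norms of the undeformed hcp points -/

/-- `latPt G f b = G (latPt 1 f b)`. [formal bookkeeping] -/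
theorem latPt_eq_apply_one (G : E3 →L[ℝ] E3) (f : Fin 3 → E3) (b : Fin 3 → ℤ) : latPt G f b = G (latPt 1 f b) := by
  simp [latPt]

/-- First coordinate of `P b = Σ bᵢ hexFrameᵢ`: `b₁ + b₂/2`. [arithmetic] -/
theorem hexPt_apply_zero (b : Fin 3 → ℤ) : (latPt 1 hexFrame b) 0 = (b 0 : ℝ) + (b 1 : ℝ) / 2 := by
  simp [latPt, hexFrame, Fin.sum_univ_three]
  ring

/-- Second coordinate of `P b`: `(√3/2)·b₂`. [arithmetic] -/
theorem hexPt_apply_one (b : Fin 3 → ℤ) : (latPt 1 hexFrame b) 1 = Real.sqrt 3 / 2 * (b 1 : ℝ) := by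
  simp [latPt, hexFrame, Fin.sum_univ_three]
  ring

/-- Third coordinate of `P b`: `√(8/3)·b₃`. [arithmetic] -/
theorem hexPt_apply_two (b : Fin 3 → ℤ) : (latPt 1 hexFrame b) 2 = Real.sqrt (8 / 3) * (b 2 : ℝ) := by
  simp [latPt, hexFrame, Fin.sum_univ_three]
  ring

/-- Coordinates of `hcpShift = (1/2, √3/6, √(2/3))`. [arithmetic] -/
theorem hcpShift_apply : hcpShift 0 = 1 / 2 ∧ hcpShift 1 = Real.sqrt 3 / 6 ∧ hcpShift 2 = Real.sqrt (2 / 3) := by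
  refine ⟨?_, ?_, ?_⟩ <;> simp [hcpShift]

/-- ★ `‖P b‖² = b₁² + b₁b₂ + b₂² + (8/3)·b₃²` (ideal hcp, `a = 1`, `c = √(8/3)`). [arithmetic] -/
theorem norm_sq_hexPt (b : Fin 3 → ℤ) :
    ‖latPt 1 hexFrame b‖ ^ 2 = (b 0 : ℝ) ^ 2 + (b 0 : ℝ) * b 1 + (b 1 : ℝ) ^ 2 + 8 / 3 * (b 2 : ℝ) ^ 2 := by
  rw [EuclideanSpace.norm_sq_eq, Fin.sum_univ_three, Real.norm_eq_abs, Real.norm_eq_abs, Real.norm_eq_abs, sq_abs, sq_abs, sq_abs,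
    hexPt_apply_zero, hexPt_apply_one, hexPt_apply_two]
  have h3 : Real.sqrt 3 ^ 2 = 3 := Real.sq_sqrt (by norm_num)
  have h83 : Real.sqrt (8 / 3) ^ 2 = 8 / 3 := Real.sq_sqrt (by norm_num)
  linear_combination ((b 1 : ℝ) ^ 2 / 4) * h3 + ((b 2 : ℝ) ^ 2) * h83

/-- ★ `‖P b + hcpShift‖² = (b₁ + b₂/2 + 1/2)² + ¾(b₂ + 1/3)² + (8/3)(b₃ + 1/2)²`. [arithmetic] -/
theorem norm_sq_hexPt_add_shift (b : Fin 3 → ℤ) :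
    ‖latPt 1 hexFrame b + hcpShift‖ ^ 2 =
      ((b 0 : ℝ) + b 1 / 2 + 1 / 2) ^ 2 + 3 / 4 * ((b 1 : ℝ) + 1 / 3) ^ 2 + 8 / 3 * ((b 2 : ℝ) + 1 / 2) ^ 2 := by
  rw [EuclideanSpace.norm_sq_eq, Fin.sum_univ_three, Real.norm_eq_abs, Real.norm_eq_abs, Real.norm_eq_abs, sq_abs, sq_abs, sq_abs]
  simp only [PiLp.add_apply, hexPt_apply_zero, hexPt_apply_one, hexPt_apply_two, hcpShift_apply.1, hcpShift_apply.2.1,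
    hcpShift_apply.2.2]
  have h3 : Real.sqrt 3 ^ 2 = 3 := Real.sq_sqrt (by norm_num)
  have h83 : Real.sqrt (8 / 3) ^ 2 = 8 / 3 := Real.sq_sqrt (by norm_num)
  have h23 : Real.sqrt (2 / 3) ^ 2 = 2 / 3 := Real.sq_sqrt (by norm_num)
  have hx : Real.sqrt (8 / 3) * Real.sqrt (2 / 3) = 4 / 3 := by
    rw [← Real.sqrt_mul (by norm_num), show (8 / 3 * (2 / 3) : ℝ) = (4 / 3) ^ 2 by norm_num, Real.sqrt_sq (by norm_num)]
  linear_combination (((b 1 : ℝ) / 2 + 1 / 6) ^ 2) * h3 + ((b 2 : ℝ) ^ 2) * h83 + h23 + (2 * (b 2 : ℝ)) * hx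

/-! ## §2. Injectivity, non-vanishing and non-meeting of the two families -/

/-- `b ≠ 0 ⟹ ‖P b‖² ≥ 1` (`b₁² + b₁b₂ + b₂²` and `b₃²` are nonnegative integers, not both zero). [folklore] -/
theorem one_le_norm_sq_hexPt {b : Fin 3 → ℤ} (hb : b ≠ 0) : 1 ≤ ‖latPt 1 hexFrame b‖ ^ 2 := by
  rw [norm_sq_hexPt]
  have hint : 1 ≤ (b 0) ^ 2 + b 0 * b 1 + (b 1) ^ 2 + 2 * (b 2) ^ 2 := by
    by_contra hlt
    have hle : (b 0) ^ 2 + b 0 * b 1 + (b 1) ^ 2 + 2 * (b 2) ^ 2 ≤ 0 := by linarith [Int.lt_iff_add_one_le.mp (not_le.mp hlt)]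
    have hq : 0 ≤ (b 0) ^ 2 + b 0 * b 1 + (b 1) ^ 2 := by nlinarith [sq_nonneg (2 * b 0 + b 1), sq_nonneg (b 1)]
    have h2 : (b 2) ^ 2 = 0 := le_antisymm (by nlinarith [sq_nonneg (b 2)]) (sq_nonneg _)
    have hq0 : 4 * ((b 0) ^ 2 + b 0 * b 1 + (b 1) ^ 2) = (2 * b 0 + b 1) ^ 2 + 3 * (b 1) ^ 2 := by ring
    have h1 : (b 1) ^ 2 = 0 := le_antisymm (by nlinarith [sq_nonneg (2 * b 0 + b 1), sq_nonneg (b 2)]) (sq_nonneg _)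
    have e1 : b 1 = 0 := (pow_eq_zero_iff two_ne_zero).1 h1
    have h0 : (b 0) ^ 2 = 0 := le_antisymm (by nlinarith [sq_nonneg (b 2)]) (sq_nonneg _)
    have e0 : b 0 = 0 := (pow_eq_zero_iff two_ne_zero).1 h0
    have e2 : b 2 = 0 := (pow_eq_zero_iff two_ne_zero).1 h2
    exact hb (funext fun i => by fin_cases i <;> simp [e0, e1, e2])
  have hcast : (1 : ℝ) ≤ (((b 0) ^ 2 + b 0 * b 1 + (b 1) ^ 2 + 2 * (b 2) ^ 2 : ℤ) : ℝ) := by exact_mod_cast hint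
  push_cast at hcast
  nlinarith [sq_nonneg ((b 2 : ℤ) : ℝ)]

/-- ★ `P = latPt 1 hexFrame` is injective. [folklore] -/
theorem hexPt_injective : Function.Injective (latPt 1 hexFrame) := by
  intro a b h
  by_contra hne
  have hsub : latPt 1 hexFrame (a - b) = 0 := by rw [latPt_sub, h, sub_self]
  have h1 := one_le_norm_sq_hexPt (sub_ne_zero.2 hne)
  rw [hsub, norm_zero] at h1
  norm_num at h1

/-- ★ `‖G − 1‖ ≤ 1/4 ⟹ b ↦ latPt G hexFrame b` is injective. [folklore] -/
theorem latPt_hex_injective {G : E3 →L[ℝ] E3} (hG : ‖G - 1‖ ≤ 1 / 4) : Function.Injective (latPt G hexFrame) := fun a b h => by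
  rw [latPt_eq_apply_one, latPt_eq_apply_one G hexFrame b] at h
  exact hexPt_injective (injective_of_near_one hG h)

/-- `‖P b + hcpShift‖² ≥ 2/3` for EVERY label (the `c`-axis term alone: `(8/3)(b₃ + 1/2)² ≥ 2/3`). [folklore] -/
theorem twoThirds_le_norm_sq_hexPt_add_shift (b : Fin 3 → ℤ) : 2 / 3 ≤ ‖latPt 1 hexFrame b + hcpShift‖ ^ 2 := by
  rw [norm_sq_hexPt_add_shift]
  have hhalf : (1 : ℝ) / 4 ≤ ((b 2 : ℝ) + 1 / 2) ^ 2 := by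
    rcases le_or_gt 0 (b 2) with h | h
    · have : (0 : ℝ) ≤ b 2 := by exact_mod_cast h
      nlinarith
    · have h' : b 2 ≤ -1 := by omega
      have : (b 2 : ℝ) ≤ -1 := by exact_mod_cast h'
      nlinarith
  nlinarith [sq_nonneg ((b 0 : ℝ) + b 1 / 2 + 1 / 2), sq_nonneg ((b 1 : ℝ) + 1 / 3)]

/-- ★ `‖ξ‖ ≤ 1/4 ⟹ ‖P b + hcpShift + ξ‖ > 1/2` (`√(2/3) − 1/4 > 1/2`). [folklore] -/
theorem half_lt_norm_hexPt_add_shift_add {ξ : E3} (hξ : ‖ξ‖ ≤ 1 / 4) (b : Fin 3 → ℤ) :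
    1 / 2 < ‖latPt 1 hexFrame b + hcpShift + ξ‖ := by
  have h23 := twoThirds_le_norm_sq_hexPt_add_shift b
  have h34 : (3 : ℝ) / 4 < ‖latPt 1 hexFrame b + hcpShift‖ := by
    have hsq : ((3 : ℝ) / 4) ^ 2 < ‖latPt 1 hexFrame b + hcpShift‖ ^ 2 := by nlinarith
    exact (abs_lt_of_sq_lt_sq' hsq (norm_nonneg _)).2
  have htri : ‖latPt 1 hexFrame b + hcpShift‖ ≤ ‖latPt 1 hexFrame b + hcpShift + ξ‖ + ‖ξ‖ := by
    calc ‖latPt 1 hexFrame b + hcpShift‖ = ‖(latPt 1 hexFrame b + hcpShift + ξ) - ξ‖ := by rw [add_sub_cancel_right]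
      _ ≤ ‖latPt 1 hexFrame b + hcpShift + ξ‖ + ‖ξ‖ := norm_sub_le _ _
  linarith

/-- The shifted family through `G`: `latPt G hexFrame b + G (hcpShift + ξ) = G (P b + hcpShift + ξ)`. [formal bookkeeping] -/
theorem shifted_eq_apply {G : E3 →L[ℝ] E3} {ξ : E3} (b : Fin 3 → ℤ) :
    latPt G hexFrame b + G (hcpShift + ξ) = G (latPt 1 hexFrame b + hcpShift + ξ) := by
  rw [latPt_eq_apply_one, ← map_add, add_assoc]

/-- ★ The shifted family never vanishes: `‖latPt G hexFrame b + G (hcpShift + ξ)‖ > 3/8`. [folklore] -/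
theorem norm_shifted_gt {G : E3 →L[ℝ] E3} {ξ : E3} (hG : ‖G - 1‖ ≤ 1 / 4) (hξ : ‖ξ‖ ≤ 1 / 4) (b : Fin 3 → ℤ) :
    3 / 8 < ‖latPt G hexFrame b + G (hcpShift + ξ)‖ := by
  rw [shifted_eq_apply]
  have := norm_apply_ge_of_near_one hG (latPt 1 hexFrame b + hcpShift + ξ)
  linarith [half_lt_norm_hexPt_add_shift_add hξ b]

/-- ★ The shifted family never meets the unshifted one. [folklore] -/
theorem shifted_ne_unshifted {G : E3 →L[ℝ] E3} {ξ : E3} (hG : ‖G - 1‖ ≤ 1 / 4) (hξ : ‖ξ‖ ≤ 1 / 4) (b b' : Fin 3 → ℤ) :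
    latPt G hexFrame b + G (hcpShift + ξ) ≠ latPt G hexFrame b' := by
  intro h
  have hzero : latPt G hexFrame (b - b') + G (hcpShift + ξ) = 0 := by
    rw [latPt_sub, sub_add_eq_add_sub, h, sub_self]
  have hpos := norm_shifted_gt hG hξ (b - b')
  rw [hzero, norm_zero] at hpos
  linarith

/-! ## §3. The coordinate boxes (record literals: range `9/2`, hence `‖P b‖ < 6`, `‖P b + hcpShift‖ < 25/4`; box `[−7, 7]³`) -/

/-- Integer bookkeeping: real bounds `−8 < n < 8` put `n` in `[−7, 7]`. [arithmetic] -/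
theorem mem_Icc_seven_of_bounds {n : ℤ} (h1 : ((n : ℤ) : ℝ) < 8) (h2 : (-8 : ℝ) < n) : n ∈ Finset.Icc (-7 : ℤ) 7 := by
  have h1' : n < 8 := by exact_mod_cast h1
  have h2' : -8 < n := by exact_mod_cast h2
  exact Finset.mem_Icc.2 ⟨by omega, by omega⟩

/-- ★ **Box, unshifted family**: `‖P b‖ < 6 ⟹ b ∈ [−7, 7]³` (`¾bᵢ² ≤ b₁² + b₁b₂ + b₂²`, `(8/3)b₃² ≤ ‖P b‖²`). [folklore] -/
theorem mem_box_of_norm_hexPt_lt {b : Fin 3 → ℤ} (hb : ‖latPt 1 hexFrame b‖ < 6) :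
    b ∈ Fintype.piFinset fun _ : Fin 3 => Finset.Icc (-7 : ℤ) 7 := by
  have hn := norm_nonneg (latPt 1 hexFrame b)
  have hsq : ‖latPt 1 hexFrame b‖ ^ 2 < 36 := by nlinarith
  rw [norm_sq_hexPt] at hsq
  have h0u : ((b 0 : ℤ) : ℝ) < 8 := by nlinarith [sq_nonneg (((b 0 : ℤ) : ℝ) + 2 * b 1), sq_nonneg ((b 2 : ℤ) : ℝ), sq_nonneg (((b 0 : ℤ) : ℝ) - 8)]
  have h0l : (-8 : ℝ) < b 0 := by nlinarith [sq_nonneg (((b 0 : ℤ) : ℝ) + 2 * b 1), sq_nonneg ((b 2 : ℤ) : ℝ), sq_nonneg (((b 0 : ℤ) : ℝ) + 8)]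
  have h1u : ((b 1 : ℤ) : ℝ) < 8 := by nlinarith [sq_nonneg (2 * ((b 0 : ℤ) : ℝ) + b 1), sq_nonneg ((b 2 : ℤ) : ℝ), sq_nonneg (((b 1 : ℤ) : ℝ) - 8)]
  have h1l : (-8 : ℝ) < b 1 := by nlinarith [sq_nonneg (2 * ((b 0 : ℤ) : ℝ) + b 1), sq_nonneg ((b 2 : ℤ) : ℝ), sq_nonneg (((b 1 : ℤ) : ℝ) + 8)]
  have h2u : ((b 2 : ℤ) : ℝ) < 8 := by nlinarith [sq_nonneg (2 * ((b 0 : ℤ) : ℝ) + b 1), sq_nonneg ((b 1 : ℤ) : ℝ), sq_nonneg (((b 2 : ℤ) : ℝ) - 8)]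
  have h2l : (-8 : ℝ) < b 2 := by nlinarith [sq_nonneg (2 * ((b 0 : ℤ) : ℝ) + b 1), sq_nonneg ((b 1 : ℤ) : ℝ), sq_nonneg (((b 2 : ℤ) : ℝ) + 8)]
  exact Fintype.mem_piFinset.2 fun i => by
    fin_cases i
    · exact mem_Icc_seven_of_bounds h0u h0l
    · exact mem_Icc_seven_of_bounds h1u h1l
    · exact mem_Icc_seven_of_bounds h2u h2l

/-- ★ **Box, shifted family**: `‖P b + hcpShift‖ < 25/4 ⟹ b ∈ [−7, 7]³` (with `u = b₁ + 1/3`, `w = b₂ + 1/3`: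
`‖P b + s‖² = u² + uw + w² + (8/3)(b₃ + 1/2)²`, `¾u², ¾w² ≤ u² + uw + w²`). [folklore] -/
theorem mem_box_of_norm_hexPt_add_shift_lt {b : Fin 3 → ℤ} (hb : ‖latPt 1 hexFrame b + hcpShift‖ < 25 / 4) :
    b ∈ Fintype.piFinset fun _ : Fin 3 => Finset.Icc (-7 : ℤ) 7 := by
  have hn := norm_nonneg (latPt 1 hexFrame b + hcpShift)
  have hsq : ‖latPt 1 hexFrame b + hcpShift‖ ^ 2 < 625 / 16 := by nlinarith
  rw [norm_sq_hexPt_add_shift] at hsq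
  have h0u : ((b 0 : ℤ) : ℝ) < 8 := by
    nlinarith [sq_nonneg ((((b 0 : ℤ) : ℝ) + 1 / 3) / 2 + (b 1 + 1 / 3)), sq_nonneg (((b 2 : ℤ) : ℝ) + 1 / 2), sq_nonneg (((b 0 : ℤ) : ℝ) - 8)]
  have h0l : (-8 : ℝ) < b 0 := by
    nlinarith [sq_nonneg ((((b 0 : ℤ) : ℝ) + 1 / 3) / 2 + (b 1 + 1 / 3)), sq_nonneg (((b 2 : ℤ) : ℝ) + 1 / 2), sq_nonneg (((b 0 : ℤ) : ℝ) + 8)]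
  have h1u : ((b 1 : ℤ) : ℝ) < 8 := by
    nlinarith [sq_nonneg (((b 0 : ℤ) : ℝ) + b 1 / 2 + 1 / 2), sq_nonneg (((b 2 : ℤ) : ℝ) + 1 / 2), sq_nonneg (((b 1 : ℤ) : ℝ) - 8)]
  have h1l : (-8 : ℝ) < b 1 := by
    nlinarith [sq_nonneg (((b 0 : ℤ) : ℝ) + b 1 / 2 + 1 / 2), sq_nonneg (((b 2 : ℤ) : ℝ) + 1 / 2), sq_nonneg (((b 1 : ℤ) : ℝ) + 8)]
  have h2u : ((b 2 : ℤ) : ℝ) < 8 := by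
    nlinarith [sq_nonneg (((b 0 : ℤ) : ℝ) + b 1 / 2 + 1 / 2), sq_nonneg (((b 1 : ℤ) : ℝ) + 1 / 3), sq_nonneg (((b 2 : ℤ) : ℝ) - 8)]
  have h2l : (-8 : ℝ) < b 2 := by
    nlinarith [sq_nonneg (((b 0 : ℤ) : ℝ) + b 1 / 2 + 1 / 2), sq_nonneg (((b 1 : ℤ) : ℝ) + 1 / 3), sq_nonneg (((b 2 : ℤ) : ℝ) + 8)]
  exact Fintype.mem_piFinset.2 fun i => by
    fin_cases i
    · exact mem_Icc_seven_of_bounds h0u h0l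
    · exact mem_Icc_seven_of_bounds h1u h1l
    · exact mem_Icc_seven_of_bounds h2u h2l

/-! ## §4. The enumeration lemma (record literals) -/

/-- ★★ **INDEX-BOX ENUMERATION, hcp, record literals** (`‖G − 1‖ ≤ 1/4`, `‖ξ‖ ≤ 1/4`, `W₄₅` vanishing from `9/2`):
`∑ᶠ v ∈ T_A ∖ 0, W₄₅ ‖v‖ = Σ_{b ∈ [−7,7]³ ∖ 0} W₄₅ ‖latPt G hexFrame b‖ + Σ_{b ∈ [−7,7]³} W₄₅ ‖latPt G hexFrame b + G (hcpShift + ξ)‖`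
(`3374 + 3375` labels; the two families are disjoint and individually injective). [folklore] -/
theorem latticeSum_hcp_eq_boxSum_record {G : E3 →L[ℝ] E3} {ξ : E3} (hG : ‖G - 1‖ ≤ 1 / 4) (hξ : ‖ξ‖ ≤ 1 / 4) :
    ∑ᶠ v ∈ {v : E3 | v ≠ 0 ∧ ∃ b : Fin 3 → ℤ, v = latPt G hexFrame b ∨ v = latPt G hexFrame b + G (hcpShift + ξ)},
        effPot w₄₅ ω₄ (3 / 400) ‖v‖ =
      ∑ b ∈ (Fintype.piFinset fun _ : Fin 3 => Finset.Icc (-7 : ℤ) 7).filter (fun b => b ≠ 0), effPot w₄₅ ω₄ (3 / 400) ‖latPt G hexFrame b‖ +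
        ∑ b ∈ (Fintype.piFinset fun _ : Fin 3 => Finset.Icc (-7 : ℤ) 7), effPot w₄₅ ω₄ (3 / 400) ‖latPt G hexFrame b + G (hcpShift + ξ)‖ := by
  set box : Finset (Fin 3 → ℤ) := Fintype.piFinset fun _ : Fin 3 => Finset.Icc (-7 : ℤ) 7 with hbox
  set F₁ : Finset E3 := (box.filter (fun b => b ≠ 0)).image (latPt G hexFrame) with hF₁
  set F₂ : Finset E3 := box.image (fun b => latPt G hexFrame b + G (hcpShift + ξ)) with hF₂
  have hinj := latPt_hex_injective hG
  have hinj₂ : Function.Injective (fun b : Fin 3 → ℤ => latPt G hexFrame b + G (hcpShift + ξ)) :=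
    fun a b h => hinj (add_right_cancel h)
  have hW : ∀ r : ℝ, (9 : ℝ) / 2 ≤ r → effPot w₄₅ ω₄ (3 / 400) r = 0 := fun r hr => effPot_fourHalf_eq_zero _ hr
  -- Step 1: replace the displacement set by the finite set `F₁ ∪ F₂` on the support of the summand
  rw [finsum_mem_inter_support_eq' (fun v : E3 => effPot w₄₅ ω₄ (3 / 400) ‖v‖)
    {v : E3 | v ≠ 0 ∧ ∃ b : Fin 3 → ℤ, v = latPt G hexFrame b ∨ v = latPt G hexFrame b + G (hcpShift + ξ)} (↑(F₁ ∪ F₂)) ?_]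
  · -- Step 2: finite bookkeeping
    rw [finsum_mem_coe_finset, Finset.sum_union, Finset.sum_image fun a _ b _ h => hinj h,
      Finset.sum_image fun a _ b _ h => hinj₂ h]
    rw [Finset.disjoint_left]
    intro v hv1 hv2
    obtain ⟨b', -, rfl⟩ := Finset.mem_image.1 hv1
    obtain ⟨b, -, hb⟩ := Finset.mem_image.1 hv2
    exact shifted_ne_unshifted hG hξ b b' hb
  · intro v hv
    have hlt : ‖v‖ < 9 / 2 := lt_of_not_ge fun h => hv (hW _ h)
    simp only [Finset.coe_union, Set.mem_union, Finset.mem_coe, Set.mem_setOf_eq]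
    constructor
    · rintro ⟨hv0, b, h | h⟩
      · refine Or.inl (Finset.mem_image.2 ⟨b, Finset.mem_filter.2 ⟨?_, fun hb0 => hv0 (by rw [h, hb0, latPt_zero])⟩, h.symm⟩)
        have h34 := norm_apply_ge_of_near_one hG (latPt 1 hexFrame b)
        rw [← latPt_eq_apply_one, ← h] at h34
        exact mem_box_of_norm_hexPt_lt (by linarith)
      · refine Or.inr (Finset.mem_image.2 ⟨b, ?_, h.symm⟩)
        have h34 := norm_apply_ge_of_near_one hG (latPt 1 hexFrame b + hcpShift + ξ)
        rw [← shifted_eq_apply, ← h] at h34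
        have htri : ‖latPt 1 hexFrame b + hcpShift‖ ≤ ‖latPt 1 hexFrame b + hcpShift + ξ‖ + ‖ξ‖ := by
          calc ‖latPt 1 hexFrame b + hcpShift‖ = ‖(latPt 1 hexFrame b + hcpShift + ξ) - ξ‖ := by rw [add_sub_cancel_right]
            _ ≤ ‖latPt 1 hexFrame b + hcpShift + ξ‖ + ‖ξ‖ := norm_sub_le _ _
        exact mem_box_of_norm_hexPt_add_shift_lt (by linarith)
    · rintro (h1 | h2)
      · obtain ⟨b, hb, rfl⟩ := Finset.mem_image.1 h1
        have hb0 : b ≠ 0 := (Finset.mem_filter.1 hb).2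
        exact ⟨fun h => hb0 (hinj (by rw [h, latPt_zero])), b, Or.inl rfl⟩
      · obtain ⟨b, -, rfl⟩ := Finset.mem_image.1 h2
        refine ⟨fun h => ?_, b, Or.inr rfl⟩
        have hpos := norm_shifted_gt hG hξ b
        rw [h, norm_zero] at hpos
        linarith

/-- The punctured box as an `erase` (critic row 760 guard: either spelling of `[−K,K]³ ∖ 0` rewrites by `rw`). [formal bookkeeping] -/
theorem box_filter_ne_zero_eq_erase (K : ℤ) :
    (Fintype.piFinset fun _ : Fin 3 => Finset.Icc (-K) K).filter (fun b => b ≠ 0) =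
      (Fintype.piFinset fun _ : Fin 3 => Finset.Icc (-K) K).erase 0 := by
  ext b
  simp only [Finset.mem_filter, Finset.mem_erase]
  exact and_comm

/-! ## §5. `HomFloor m` from the two box-sum inequalities -/

/-- ★★★ **THE CERTIFICATE'S TOP-LEVEL STATEMENT** (critic row 758): `HomFloor m` follows from the fcc BOX-SUM inequality over `[−7,7]³ ∖ 0` for
every `‖G − 1‖ ≤ 1/4` and the hcp BOX-SUM inequality over `([−7,7]³ ∖ 0) ⊔ [−7,7]³` for every `‖G − 1‖ ≤ 1/4`, `‖ξ‖ ≤ 1/4` — finitely many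
explicit terms per deformation, no `finsum`, no cluster. [folklore] -/
theorem homFloor_of_boxSums {m : ℝ}
    (hfcc : ∀ G : E3 →L[ℝ] E3, ‖G - 1‖ ≤ 1 / 4 →
      m ≤ (∑ b ∈ (Fintype.piFinset fun _ : Fin 3 => Finset.Icc (-7 : ℤ) 7).filter (fun b => b ≠ 0),
        effPot w₄₅ ω₄ (3 / 400) ‖latPt G fccVec b‖) / 2 - (-(7175 / 10000) + 3 / 400))
    (hhcp : ∀ (G : E3 →L[ℝ] E3) (ξ : E3), ‖G - 1‖ ≤ 1 / 4 → ‖ξ‖ ≤ 1 / 4 →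
      m ≤ (∑ b ∈ (Fintype.piFinset fun _ : Fin 3 => Finset.Icc (-7 : ℤ) 7).filter (fun b => b ≠ 0),
          effPot w₄₅ ω₄ (3 / 400) ‖latPt G hexFrame b‖ +
        ∑ b ∈ (Fintype.piFinset fun _ : Fin 3 => Finset.Icc (-7 : ℤ) 7),
          effPot w₄₅ ω₄ (3 / 400) ‖latPt G hexFrame b + G (hcpShift + ξ)‖) / 2 - (-(7175 / 10000) + 3 / 400)) :
    HomFloor m :=
  homFloor_of_boxSum_fcc_of_latticeSum_hcp hfcc fun G ξ hG hξ => by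
    rw [latticeSum_hcp_eq_boxSum_record hG hξ]; exact hhcp G ξ hG hξ

end Summit.AtomisticToContinuum.Crystallization.Theorems.FrustratedLawDichotomyStrainedPatchHomLatticeBoxHcp

end
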